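import Literature.IUT.HodgeTheaters.CoveringsErrata
import Literature.IUT.HodgeTheaters.CountableAbsoluteGaloisGroup
import Literature.IUT.HodgeTheaters.CoveringsErrataVerticial
import HarnessLib

/-!
# [IUTchI] Remarks 1.2.3 (vii), 2.5.3 (ii) (E1) — discharges of the typed claims of `CoveringsErrata.lean`

Proof-only companion of `CoveringsErrata.lean` (abc-iut cell, layer L5, abc-iut-L5-t6), kurims
manuscript [IUTchI] pp. 43, 53:

* `Rmk253.countableFieldGaloisSecondCountable_holds`, `Rmk253.e1Statement_holds` — Rmk. 2.5.3 (ii)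
  (E1) "all topological subquotients of absolute Galois groups of fields of countable cardinality are
  Galois-countable" HOLDS (via `CountableAbsoluteGaloisGroup.lean`: Mathlib's Krull topology on
  `Field.absoluteGaloisGroup K` is second countable for `K` countable, and the subquotient passage of
  `CoveringsErrata.lean`).
* `Rmk123.unrVerticialSufficiency_holds` — Rmk. 1.2.3 (vii), first sentence ("Sufficiency is
  immediate" for [CombGC] Thm. 1.6 (iii)) HOLDS for every origin predicate `Ω` (via
  `CoveringsErrataVerticial.lean`, which proves it for all `PSCDatum`s).

The (E2) discharge in print's form (`tameGaloisCountable_of_geomTFG`, over [AbsTopI] Prop. 2.2 and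
`AbsoluteAnabelian/SecondCountableExtension.lean`) is the sibling file `CoveringsErrataProofsE2.lean`.
Elementary; nothing here takes a side on [IUTchIII] Cor. 3.12.
-/

namespace Literature.IUT.HodgeTheaters

universe u

namespace Rmk253

/-- **[IUTchI] Remark 2.5.3 (ii) (E1)**, p. 53, core case, DISCHARGED: for every countable field `K`,
`Field.absoluteGaloisGroup K` is second countable. [cite: Mochizuki2012, IUTchI Rmk 2.5.3 (ii) (E1) p.53] -/
theorem countableFieldGaloisSecondCountable_holds : CountableFieldGaloisSecondCountable.{u} :=
  fun K _ _ => secondCountableTopology_absoluteGaloisGroup K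

/-- **[IUTchI] Remark 2.5.3 (ii) (E1)**, p. 53, as printed, DISCHARGED: all topological subquotients
of absolute Galois groups of countable fields are second countable.
[cite: Mochizuki2012, IUTchI Rmk 2.5.3 (ii) (E1) p.53] -/
theorem e1Statement_holds : E1Statement.{u} :=
  e1Statement_of_countableFieldGaloisSecondCountable countableFieldGaloisSecondCountable_holds

end Rmk253

namespace Rmk123

open Literature.AnabelianGeometry.SemiGraphs

/-- **[IUTchI] Remark 1.2.3 (vii)**, p. 43, first sentence ("Sufficiency is immediate" for [CombGC]
Thm. 1.6 (iii)), DISCHARGED for every origin predicate `Ω`: group-theoretically verticial ⇒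
verticially filtration-preserving (indeed for all `PSCDatum`s, `CoveringsErrataVerticial.lean`).
[cite: Mochizuki2012, IUTchI Rmk 1.2.3 (vii) p.43] -/
theorem unrVerticialSufficiency_holds (Ω : PSCOrigin.{u}) : UnrVerticialSufficiency Ω :=
  fun _ _ _ _ _ _ _ _ G H β _ _ _ _ hβ =>
    isUnrVerticiallyFiltrationPreserving_of_isUnrGroupTheoreticallyVerticial G H β hβ

end Rmk123

end Literature.IUT.HodgeTheaters
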